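import Summits.CriticalPhenomena.PercolationContinuityZ3.Theorems.SahiMasterFamilyKahnModule

/-!
# Kahn pairs on disjoint blocks: the TENSOR IDENTITY and the second-order defect bound
# (lineage `prim-master-conj`, gen 55; `--supports stmt-CriticalPhenomena-4575`)

Setting of `…SahiMasterFamilyKahnModule{Prelim,}`: `X`, `Y` finite preorders with probability weights `w, w'`; `g₁, h₁` monotone
indicators on `X` (`b₁ = E g₁`, `c₁ = E h₁`, `d₁ = E(g₁h₁)`, `κ₁ = d₁ − b₁c₁`), `g₂, h₂` on `Y` likewise; on `X × Y` the TENSOR pair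
`(g₁⊗g₂, h₁⊗h₂) = (liftX g₁ · liftY g₂, liftX h₁ · liftY h₂)` ("`(B₁ ∧ B₂, C₁ ∧ C₂)` with `B₁, C₁` on the block `X` and `B₂, C₂` on the
disjoint block `Y`").  CONJECTURE T⊗ of the lineage (memo gen 55 §3b; LP certificates in all 1 524 tested block instances, no proof): tensor
products of Kahn pairs are Kahn pairs.  This file proves the exact reduction behind it:

* `kahnK_tensor_eq` — **the tensor identity**, as an identity of functionals of the test function `F`:
  `E₃(F, g₁⊗g₂, h₁⊗h₂) = E_Y[g₂h₂ · E₃,X(F_y, g₁, h₁)] + c₁·E[F·g₁⊗(g₂(h₂−c₂))] + b₁·E[F·h₁⊗(h₂(g₂−b₂))] + κ₁·(E[F·1⊗g₂h₂] − d₂·E F) − b₁c₁κ₂·E F`;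
* `kahnK_tensor_ge` — **the defect bound**: if `(g₁,h₁)` is a Kahn pair on `X` and `Y` is Harris, then for every monotone `F ≥ 0`
  `E₃(F, g₁⊗g₂, h₁⊗h₂) ≥ −b₁c₁κ₂ · E F` (Kahn's inequality for the tensor pair up to the second-order defect `b₁c₁κ₂`; the four other terms
  are nonnegative: fibrewise Kahn on `X`, conditional Harris on `Y` twice, Harris on `Y`);
* `kahnPair_tensor_of_cov_eq_zero` — in particular the tensor pair IS a Kahn pair when `κ₂ = 0` (the `Y`-factors uncorrelated),
  with no hypothesis on `(g₂,h₂)` beyond monotone indicators.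
Nothing here asserts T⊗ or Kahn's Conjecture 5.  [this work]
-/

open Finset
open scoped BigOperators

namespace Summit.CriticalPhenomena.PercolationContinuityZ3.Theorems.SahiKahnModule

variable {X Y : Type*} [Fintype X] [Fintype Y] [Preorder X] [Preorder Y]

omit [Preorder X] [Preorder Y] in
/-- Fibre form of `E(F · φ̃₁ · φ̃₂)` for `φ₁` on `X`, `φ₂` on `Y`: `= E_Y(φ₂ · E_X(F_y φ₁))`. [this work] -/
theorem ex_F_liftX_liftY (w : X → ℝ) (w' : Y → ℝ) (F : X × Y → ℝ) (φ₁ : X → ℝ) (φ₂ : Y → ℝ) :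
    ex (prodW w w') (F * liftX φ₁ * liftY φ₂) = ex w' (fun y => φ₂ y * ex w ((fun x => F (x, y)) * φ₁)) := by
  rw [ex_prodW]; refine congrArg _ (funext fun y => ?_)
  unfold ex; rw [mul_sum]; exact sum_congr rfl fun x _ => by simp only [Pi.mul_apply, liftX, liftY]; ring

omit [Fintype X] [Preorder X] [Preorder Y] in
/-- Linearity bookkeeping on `Y` (right-hand side of the tensor identity). [this work] -/
theorem ex_lin_tensor (w' : Y → ℝ) (u D G H a P Q R : Y → ℝ) (b₁ c₁ d₁ c₁' b₁' κ₁ bcκ : ℝ) :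
    ex w' (fun y => u y * (2 * D y - G y * c₁ - H y * b₁ - d₁ * a y + a y * b₁ * c₁)) + c₁' * ex w' P + b₁' * ex w' Q
        + κ₁ * ex w' R - bcκ * ex w' a =
      ex w' (fun y => u y * (2 * D y - G y * c₁ - H y * b₁ - d₁ * a y + a y * b₁ * c₁) + c₁' * P y + b₁' * Q y + κ₁ * R y
        - bcκ * a y) := by
  simp only [ex, mul_sum, ← sum_sub_distrib, ← sum_add_distrib]
  exact sum_congr rfl fun y _ => by ring

omit [Fintype X] [Preorder X] [Preorder Y] in
/-- Linearity bookkeeping on `Y` (left-hand side of the tensor identity). [this work] -/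
theorem ex_lin_tensor_lhs (w' : Y → ℝ) (P₁ P₂ P₃ a : Y → ℝ) (k₂ k₃ k₄ k₅ k₆ : ℝ) :
    2 * ex w' P₁ - ex w' P₂ * k₂ - ex w' P₃ * k₃ - k₄ * ex w' a + ex w' a * k₅ * k₆ =
      ex w' (fun y => 2 * P₁ y - k₂ * P₂ y - k₃ * P₃ y - k₄ * a y + k₅ * k₆ * a y) := by
  simp only [ex, mul_sum, sum_mul, ← sum_sub_distrib, ← sum_add_distrib]
  exact sum_congr rfl fun y _ => by ring

omit [Preorder X] [Preorder Y] in
/-- **THE TENSOR IDENTITY.**  For `F : X × Y → ℝ`, functions `g₁ h₁` on `X` and `g₂ h₂` on `Y` (probability weight on `Y`), with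
`b₁ = E g₁, c₁ = E h₁, d₁ = E(g₁h₁)`, `b₂, c₂, d₂` likewise and `F_y = F(·,y)`:
`E₃(F, g₁⊗g₂, h₁⊗h₂) = E_Y[g₂h₂·E₃,X(F_y,g₁,h₁)] + c₁E_Y[g₂(h₂−c₂)·E_X(F_y g₁)] + b₁E_Y[h₂(g₂−b₂)·E_X(F_y h₁)]`
`  + (d₁ − b₁c₁)·E_Y[(g₂h₂ − d₂)·E_X F_y] − b₁c₁(d₂ − b₂c₂)·E F`  — a polynomial identity (no indicator hypothesis). [this work] -/
theorem kahnK_tensor_eq {w : X → ℝ} {w' : Y → ℝ} (F : X × Y → ℝ) (g₁ h₁ : X → ℝ) (g₂ h₂ : Y → ℝ) :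
    kahnK (prodW w w') F (liftX g₁ * liftY g₂) (liftX h₁ * liftY h₂) =
      ex w' (fun y => g₂ y * h₂ y * kahnK w (fun x => F (x, y)) g₁ h₁)
      + ex w h₁ * ex w' (fun y => g₂ y * (h₂ y - ex w' h₂) * ex w ((fun x => F (x, y)) * g₁))
      + ex w g₁ * ex w' (fun y => h₂ y * (g₂ y - ex w' g₂) * ex w ((fun x => F (x, y)) * h₁))
      + (ex w (g₁ * h₁) - ex w g₁ * ex w h₁) * ex w' (fun y => (g₂ y * h₂ y - ex w' (g₂ * h₂)) * ex w (fun x => F (x, y)))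
      - ex w g₁ * ex w h₁ * (ex w' (g₂ * h₂) - ex w' g₂ * ex w' h₂) * ex (prodW w w') F := by
  have e1 : ex (prodW w w') (F * (liftX g₁ * liftY g₂) * (liftX h₁ * liftY h₂)) =
      ex w' (fun y => g₂ y * h₂ y * ex w ((fun x => F (x, y)) * g₁ * h₁)) := by
    rw [ex_prodW]; refine congrArg _ (funext fun y => ?_)
    unfold ex; rw [mul_sum]; exact sum_congr rfl fun x _ => by simp only [Pi.mul_apply, liftX, liftY]; ring
  have e2 : ex (prodW w w') (F * (liftX g₁ * liftY g₂)) = ex w' (fun y => g₂ y * ex w ((fun x => F (x, y)) * g₁)) := by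
    rw [show F * (liftX g₁ * liftY g₂ : X × Y → ℝ) = F * liftX g₁ * liftY g₂ from (mul_assoc _ _ _).symm]
    exact ex_F_liftX_liftY w w' F g₁ g₂
  have e3 : ex (prodW w w') (F * (liftX h₁ * liftY h₂)) = ex w' (fun y => h₂ y * ex w ((fun x => F (x, y)) * h₁)) := by
    rw [show F * (liftX h₁ * liftY h₂ : X × Y → ℝ) = F * liftX h₁ * liftY h₂ from (mul_assoc _ _ _).symm]
    exact ex_F_liftX_liftY w w' F h₁ h₂
  have e4 : ex (prodW w w') F = ex w' (fun y => ex w (fun x => F (x, y))) := ex_prodW _ _ _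
  have e5 : ex (prodW w w') (liftX g₁ * liftY g₂) = ex w' g₂ * ex w g₁ := ex_gv w w' g₁ g₂
  have e6 : ex (prodW w w') (liftX h₁ * liftY h₂) = ex w' h₂ * ex w h₁ := ex_gv w w' h₁ h₂
  have e7 : ex (prodW w w') (liftX g₁ * liftY g₂ * (liftX h₁ * liftY h₂)) = ex w' (g₂ * h₂) * ex w (g₁ * h₁) := by
    rw [show (liftX g₁ * liftY g₂ * (liftX h₁ * liftY h₂) : X × Y → ℝ) = liftX (g₁ * h₁) * liftY (g₂ * h₂) from by
      funext z; simp only [Pi.mul_apply, liftX, liftY]; ring]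
    exact ex_gv w w' (g₁ * h₁) (g₂ * h₂)
  unfold kahnK
  rw [e1, e2, e3, e4, e5, e6, e7, ex_lin_tensor_lhs, ex_lin_tensor]
  exact congrArg _ (funext fun y => by ring)

/-- **Defect bound for the tensor pair.**  If `(g₁,h₁)` is a Kahn pair on `X` (probability weight, indicators), `Y` is a Harris probability space
and `g₂, h₂` are monotone indicators on `Y`, then for every monotone `F ≥ 0` on `X × Y`:
`E₃(F, g₁⊗g₂, h₁⊗h₂) ≥ −b₁c₁κ₂ · E F`.  The four other terms of the tensor identity are nonnegative: fibrewise Kahn on `X`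
(weights `g₂h₂ ≥ 0`), conditional Harris on `Y` twice (`y ↦ g₂(y)·E_X(F_y g₁)` is monotone ≥ 0), Harris on `Y` times `κ₁ ≥ 0`. [this work] -/
theorem kahnK_tensor_ge {w : X → ℝ} {w' : Y → ℝ} (hw : IsProbWeight w) (hw' : IsProbWeight w') (hX : IsHarris w) (hY : IsHarris w')
    {g₁ h₁ : X → ℝ} {g₂ h₂ : Y → ℝ} (hg₁ : IsIndicator g₁) (hh₁ : IsIndicator h₁) (hg₁m : Monotone g₁) (hh₁m : Monotone h₁)
    (hg₂ : IsIndicator g₂) (hh₂ : IsIndicator h₂) (hg₂m : Monotone g₂) (hh₂m : Monotone h₂) (hK : KahnPair w g₁ h₁)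
    {F : X × Y → ℝ} (hF : Monotone F) (hF0 : ∀ z, 0 ≤ F z) :
    -(ex w g₁ * ex w h₁ * (ex w' (g₂ * h₂) - ex w' g₂ * ex w' h₂) * ex (prodW w w') F) ≤
      kahnK (prodW w w') F (liftX g₁ * liftY g₂) (liftX h₁ * liftY h₂) := by
  rw [kahnK_tensor_eq F g₁ h₁ g₂ h₂]
  have hb := ex_indicator_mem hw hg₁
  have hc := ex_indicator_mem hw hh₁
  have hκ₁ : 0 ≤ ex w (g₁ * h₁) - ex w g₁ * ex w h₁ := sub_nonneg.2 (hX g₁ h₁ hg₁m hh₁m)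
  -- (1) fibrewise Kahn on X with weights g₂h₂ ≥ 0
  have t1 : 0 ≤ ex w' (fun y => g₂ y * h₂ y * kahnK w (fun x => F (x, y)) g₁ h₁) :=
    ex_nonneg hw'.nonneg fun y => mul_nonneg (mul_nonneg (hg₂.nonneg y) (hh₂.nonneg y))
      (hK _ (monotone_fibre_left hF y) fun x => hF0 (x, y))
  -- (2),(3) conditional Harris on Y: Φ(y) = g₂(y)·E_X(F_y g₁) is monotone, so E_Y[Φ·(h₂ − c₂)] ≥ 0
  have mG : Monotone fun y => g₂ y * ex w ((fun x => F (x, y)) * g₁) := by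
    have m1 : Monotone fun y => ex w ((fun x => F (x, y)) * g₁) :=
      monotone_ex_fibre_mul hw.nonneg hF hg₁.nonneg
    exact fun a b hab => mul_le_mul (hg₂m hab) (m1 hab) (ex_nonneg hw.nonneg fun x => mul_nonneg (hF0 (x, a)) (hg₁.nonneg x))
      (hg₂.nonneg b)
  have mH : Monotone fun y => h₂ y * ex w ((fun x => F (x, y)) * h₁) := by
    have m1 : Monotone fun y => ex w ((fun x => F (x, y)) * h₁) :=
      monotone_ex_fibre_mul hw.nonneg hF hh₁.nonneg
    exact fun a b hab => mul_le_mul (hh₂m hab) (m1 hab) (ex_nonneg hw.nonneg fun x => mul_nonneg (hF0 (x, a)) (hh₁.nonneg x))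
      (hh₂.nonneg b)
  have t2 := hY.ex_mul_sub_nonneg mG hh₂m
  have t3 := hY.ex_mul_sub_nonneg mH hg₂m
  have e2 : ex w' (fun y => g₂ y * (h₂ y - ex w' h₂) * ex w ((fun x => F (x, y)) * g₁)) =
      ex w' (fun y => g₂ y * ex w ((fun x => F (x, y)) * g₁) * (h₂ y - ex w' h₂)) :=
    congrArg _ (funext fun y => by ring)
  have e3 : ex w' (fun y => h₂ y * (g₂ y - ex w' g₂) * ex w ((fun x => F (x, y)) * h₁)) =
      ex w' (fun y => h₂ y * ex w ((fun x => F (x, y)) * h₁) * (g₂ y - ex w' g₂)) :=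
    congrArg _ (funext fun y => by ring)
  -- (4) Harris on Y for (a, g₂h₂)
  have am : Monotone fun y => ex w (fun x => F (x, y)) := monotone_ex_fibre hw.nonneg hF
  have t4 := hY.ex_mul_sub_nonneg am (hg₂m.mul hh₂m hg₂.nonneg hh₂.nonneg)
  have e4 : ex w' (fun y => (g₂ y * h₂ y - ex w' (g₂ * h₂)) * ex w (fun x => F (x, y))) =
      ex w' (fun y => ex w (fun x => F (x, y)) * ((g₂ * h₂) y - ex w' (g₂ * h₂))) :=
    congrArg _ (funext fun y => by simp only [Pi.mul_apply]; ring)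
  rw [e2, e3, e4]
  nlinarith [mul_nonneg hc.1 t2, mul_nonneg hb.1 t3, mul_nonneg hκ₁ t4]

/-- **Tensor pairs with an uncorrelated second factor are Kahn pairs**: if `(g₁,h₁)` is a Kahn pair on `X` and `g₂,h₂` are monotone indicators
on the Harris space `Y` with `E(g₂h₂) = E g₂ · E h₂`, then `(g₁⊗g₂, h₁⊗h₂)` is a Kahn pair on `X × Y` (the defect vanishes). [this work] -/
theorem kahnPair_tensor_of_cov_eq_zero {w : X → ℝ} {w' : Y → ℝ} (hw : IsProbWeight w) (hw' : IsProbWeight w') (hX : IsHarris w)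
    (hY : IsHarris w') {g₁ h₁ : X → ℝ} {g₂ h₂ : Y → ℝ} (hg₁ : IsIndicator g₁) (hh₁ : IsIndicator h₁) (hg₁m : Monotone g₁)
    (hh₁m : Monotone h₁) (hg₂ : IsIndicator g₂) (hh₂ : IsIndicator h₂) (hg₂m : Monotone g₂) (hh₂m : Monotone h₂)
    (hK : KahnPair w g₁ h₁) (hcov : ex w' (g₂ * h₂) = ex w' g₂ * ex w' h₂) :
    KahnPair (prodW w w') (liftX g₁ * liftY g₂) (liftX h₁ * liftY h₂) := by
  intro F hF hF0
  have h := kahnK_tensor_ge hw hw' hX hY hg₁ hh₁ hg₁m hh₁m hg₂ hh₂ hg₂m hh₂m hK hF hF0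
  rw [hcov, sub_self] at h
  simpa using h


/-! ## The tensor step with a NESTED fresh pair (appended, gen 55)

From the tensor identity with `g₂ ≤ h₂` (so `g₂h₂ = g₂`, `d₂ = b₂`, `κ₂ = b₂(1−c₂)`):
`ψ = ψ₁⊗g₂ + κ₁·1⊗(g₂−b₂) + c₁(1−c₂)(g₁−b₁)⊗g₂ + b₁·h₁⊗(g₂ − b₂h₂) + b₁c₁(1−c₂)·1⊗(g₂−b₂)`, every term nonnegative on up-sets — so the tensor
product of a Kahn pair with a NESTED pair on a fresh Harris block is a Kahn pair.  This generalises `kahnPair_and_left` (`u' = 1`) and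
`kahnPair_and_and` (`u = u'`) to `(B ∧ U, C ∧ U')` with `U ⊆ U'` (or `U' ⊆ U`) arbitrary nested events of the fresh block. -/

/-- **Tensor step with a nested fresh pair.**  If `(g₁,h₁)` is a Kahn pair on the Harris space `X` and `u ≤ u'` are nested monotone indicators on the
Harris space `Y`, then `(g₁⊗u, h₁⊗u')` is a Kahn pair on `X × Y`.  [this work] -/
theorem kahnPair_tensor_nested {w : X → ℝ} {w' : Y → ℝ} (hw : IsProbWeight w) (hw' : IsProbWeight w') (hX : IsHarris w) (hY : IsHarris w')
    {g₁ h₁ : X → ℝ} {u u' : Y → ℝ} (hg₁ : IsIndicator g₁) (hh₁ : IsIndicator h₁) (hg₁m : Monotone g₁) (hh₁m : Monotone h₁)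
    (hu : IsIndicator u) (hu' : IsIndicator u') (hum : Monotone u) (hu'm : Monotone u') (hle : ∀ y, u y ≤ u' y) (hK : KahnPair w g₁ h₁) :
    KahnPair (prodW w w') (liftX g₁ * liftY u) (liftX h₁ * liftY u') := by
  intro F hF hF0
  rw [kahnK_tensor_eq F g₁ h₁ u u']
  have hb := ex_indicator_mem hw hg₁
  have hc := ex_indicator_mem hw hh₁
  have hb₂ := ex_indicator_mem hw' hu
  have hc₂ := ex_indicator_mem hw' hu'
  have hκ₁ : 0 ≤ ex w (g₁ * h₁) - ex w g₁ * ex w h₁ := sub_nonneg.2 (hX g₁ h₁ hg₁m hh₁m)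
  -- nestedness: u·u' = u pointwise, hence E(u u') = E u
  have huu : ∀ y, u y * u' y = u y := fun y => by
    rcases hu y with h0 | h1
    · simp [h0]
    · have : u' y = 1 := le_antisymm (hu'.le_one y) (h1 ▸ hle y); simp [h1, this]
  have euu : ex w' (u * u') = ex w' u := congrArg _ (funext fun y => by simp only [Pi.mul_apply, huu])
  -- fibre quantities
  set a : Y → ℝ := fun y => ex w (fun x => F (x, y)) with ha
  set G : Y → ℝ := fun y => ex w ((fun x => F (x, y)) * g₁) with hG
  set H : Y → ℝ := fun y => ex w ((fun x => F (x, y)) * h₁) with hH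
  have hA : 0 ≤ ex w' a := ex_nonneg hw'.nonneg fun y => ex_nonneg hw.nonneg fun x => hF0 (x, y)
  have am : Monotone a := monotone_ex_fibre hw.nonneg hF
  have Gm : Monotone G := monotone_ex_fibre_mul hw.nonneg hF hg₁.nonneg
  have Hm : Monotone H := monotone_ex_fibre_mul hw.nonneg hF hh₁.nonneg
  have H0 : ∀ y, 0 ≤ H y := fun y => ex_nonneg hw.nonneg fun x => mul_nonneg (hF0 (x, y)) (hh₁.nonneg x)
  have Gge : ∀ y, ex w g₁ * a y ≤ G y := fun y => by
    have := hX _ g₁ (monotone_fibre_left hF y) hg₁m; simp only [hG, ha]; linarith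
  -- (1) fibrewise Kahn with weights u·u' ≥ 0
  have t1 : 0 ≤ ex w' (fun y => u y * u' y * kahnK w (fun x => F (x, y)) g₁ h₁) :=
    ex_nonneg hw'.nonneg fun y => mul_nonneg (mul_nonneg (hu.nonneg y) (hu'.nonneg y)) (hK _ (monotone_fibre_left hF y) fun x => hF0 (x, y))
  -- (2) T2 = E_Y[u (u' − c₂) G] = (1 − c₂) E_Y[u G] ≥ (1 − c₂) b₂ b₁ E F
  have e2 : ex w' (fun y => u y * (u' y - ex w' u') * ex w ((fun x => F (x, y)) * g₁)) = (1 - ex w' u') * ex w' (fun y => u y * G y) := by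
    rw [← ex_smul]; refine congrArg _ (funext fun y => ?_)
    have := huu y; simp only [hG]; linear_combination (ex w ((fun x => F (x, y)) * g₁)) * this
  have uG : ex w' u * ex w' G ≤ ex w' (fun y => u y * G y) := hY u G hum Gm
  have EG : ex w g₁ * ex w' a ≤ ex w' G := by
    calc ex w g₁ * ex w' a = ex w' (fun y => ex w g₁ * a y) := (ex_smul _ _ _).symm
      _ ≤ ex w' G := ex_mono hw'.nonneg Gge
  have t2 : (1 - ex w' u') * (ex w' u * (ex w g₁ * ex w' a)) ≤
      ex w' (fun y => u y * (u' y - ex w' u') * ex w ((fun x => F (x, y)) * g₁)) := by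
    rw [e2]
    exact mul_le_mul_of_nonneg_left (le_trans (mul_le_mul_of_nonneg_left EG hb₂.1) uG) (sub_nonneg.2 hc₂.2)
  -- (3) T3 = E_Y[u'(u − b₂) H] = E_Y[u H] − b₂ E_Y[u' H] ≥ 0
  have e3 : ex w' (fun y => u' y * (u y - ex w' u) * ex w ((fun x => F (x, y)) * h₁)) =
      ex w' (fun y => u y * H y) - ex w' u * ex w' (fun y => u' y * H y) := by
    rw [← ex_smul, ← ex_sub]; refine congrArg _ (funext fun y => ?_)
    have := huu y; simp only [hH, Pi.sub_apply]; linear_combination (ex w ((fun x => F (x, y)) * h₁)) * this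
  have uH : ex w' u * ex w' H ≤ ex w' (fun y => u y * H y) := hY u H hum Hm
  have u'H : ex w' (fun y => u' y * H y) ≤ ex w' H := ex_mono hw'.nonneg fun y => by
    have := mul_le_of_le_one_left (H0 y) (hu'.le_one y); simpa using this
  have t3 : 0 ≤ ex w' (fun y => u' y * (u y - ex w' u) * ex w ((fun x => F (x, y)) * h₁)) := by
    rw [e3]; nlinarith [mul_le_mul_of_nonneg_left u'H hb₂.1]
  -- (4) Harris on Y for (a, u·u')
  have t4 := hY.ex_mul_sub_nonneg am (hum.mul hu'm hu.nonneg hu'.nonneg)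
  have e4 : ex w' (fun y => (u y * u' y - ex w' (u * u')) * ex w (fun x => F (x, y))) =
      ex w' (fun y => a y * ((u * u') y - ex w' (u * u'))) :=
    congrArg _ (funext fun y => by simp only [Pi.mul_apply, ha]; ring)
  rw [e4]
  -- assemble: the defect b₁c₁(E(uu') − b₂c₂)·E F = b₁c₁ b₂ (1 − c₂) E F is paid by (2)
  have e5 : ex (prodW w w') F = ex w' a := ex_prodW _ _ _
  rw [e5, euu]
  rw [euu] at t4
  nlinarith [mul_le_mul_of_nonneg_left t2 hc.1, mul_nonneg hb.1 t3, mul_nonneg hκ₁ t4, hb.1, hc.1, hb₂.1, hc₂.2, hA, t1]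

/-- The mirror orientation: `(g₁⊗u', h₁⊗u)` with `u ≤ u'` is a Kahn pair as well (apply `kahnPair_tensor_nested` to the swapped pair). [this work] -/
theorem kahnPair_tensor_nested' {w : X → ℝ} {w' : Y → ℝ} (hw : IsProbWeight w) (hw' : IsProbWeight w') (hX : IsHarris w) (hY : IsHarris w')
    {g₁ h₁ : X → ℝ} {u u' : Y → ℝ} (hg₁ : IsIndicator g₁) (hh₁ : IsIndicator h₁) (hg₁m : Monotone g₁) (hh₁m : Monotone h₁)
    (hu : IsIndicator u) (hu' : IsIndicator u') (hum : Monotone u) (hu'm : Monotone u') (hle : ∀ y, u y ≤ u' y) (hK : KahnPair w g₁ h₁) :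
    KahnPair (prodW w w') (liftX g₁ * liftY u') (liftX h₁ * liftY u) :=
  (kahnPair_tensor_nested hw hw' hX hY hh₁ hg₁ hh₁m hg₁m hu hu' hum hu'm hle hK.symm).symm

end Summit.CriticalPhenomena.PercolationContinuityZ3.Theorems.SahiKahnModule
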